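/-
Copyright (c) 2026 the pub-hodgecm-mathlib formalisation cell (harness21).  Prover seat hodgecm-mathlib-LH4-p12 (g0) (dealer LH4-plan (g10) WORD #33 hand «(R-15) twin prep for
tier-0 `stub_rows_unit0`»): the (D-CΔ) input of the RC-1 law socket #11S at EVERY shift schedule, from ★ U2H #5.  The shift-independence proof (§1) is LH4-r01 (g0)'s
(R-16a) kernel leg (BOX E §R, `F0/P3c/LH4/LH4-r01/g0/BoxE_RC1.byPaste.LH4r01g0.lean` 0d4b761a84feeae7), carried into the tree verbatim.  2026-09-03.
-/
import Summits.HodgeConjecture.HodgeConjecture.Theorems.F0P3cDyRamFourFrameHSideDefsR       -- ★ №2c-R p855104: `FourFrameTransferFactorS∕R`, ties `…S_shiftT_iff`; brings ★ №2c, ★ №1-R (`shiftT`, `shiftR`)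
import Summits.HodgeConjecture.HodgeConjecture.Theorems.F0P3cDyRamTransferFactorTypeOne    -- ★ p854932 (LH4-p08): `fourFrameTransferFactor_of` — the (D-CΔ) assembly
import Summits.HodgeConjecture.HodgeConjecture.Theorems.F0P3cDyRamFourFrameData            -- ★ p854865 (F0P3-p01): U1-3 `fourFrameData`
import Summits.HodgeConjecture.HodgeConjecture.Theorems.F0P3cDyRamNormPairsIffFrames        -- ★ p855010 (LH4-p14): U1-4 `normPairs_iff_frames`
import HarnessLib

/-!
# Crux `H413`, line LH4 «(D-RAM) FOUR-FRAME» road — (D-CΔ) does not depend on the parity-datum schedule: `FourFrameTransferFactorS shift N₀` at EVERY `shift`,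
# and the ★ value `FourFrameTransferFactorS shift depthOfRecord` (the `hDΔ` input of ★ #11S `anchorRows_of_fourFrameLawsS shift`)

Cell `hodgecm-mathlib` (D-0151), FLOOR 0, crux item H413 = `stmt-HodgeConjecture-24833`, route of record `HCCMUnconditional`; squad F0∕P3c∕LH4 (req620 Track A); RULING (R-16)
«RC-1» (heir LEAD F0P3a-plan (g19) T18-06∕T18-09; director g36 s1826): the κ-token `2B = n_i − d + 2 − 2t_E` is re-cut to `2B = n_i − d + 2 − 2·shift d t_E` with the schedule of
record `shiftT d t = t` and the re-cut `shiftR d t = d − d mod 2` (★ №1-R p855074, ★ №2c-R p855104, ★ #7S p855102, ★ #11S p855131).  THEOREMS ONLY (no `def`, no instance, no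
notation, no `sorry`, default heartbeats); imports ★ only; lane `--supports stmt-HodgeConjecture-24833` (count-neutral).

WHAT IS PROVED.
* §1 `fourFrameTransferFactorS_indep (s s') (N₀) : FourFrameTransferFactorS s N₀ → FourFrameTransferFactorS s' N₀` — (R-16a): in (D-CΔ)-S the parity datum `B : ℤ` is
  bound by `2B = n_i − d + 2 − 2·s d t_E` and feeds NO clause ((C), (C)₂, (Δ) do not mention `B`), so a witness for `s` re-centres to a witness for `s'`
  (`B ↦ B + s d t_E − s' d t_E`).  Proof = LH4-r01 (g0)'s BOX E §R leg, verbatim.  Hence `fourFrameTransferFactorR_iff_record (N₀) : FourFrameTransferFactorR N₀ ↔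
  FourFrameTransferFactor N₀` — the UNCONDITIONAL custody tie (every datum, not only the maximal types `d ∈ {t, t+1}`) the LEAD booked as (R-16a) «B is a dummy».
* §2 `fourFrameTransferFactor_depthOfRecord : FourFrameTransferFactor depthOfRecord` — the ★ composition U2H ED. 4 :70 writes for stub #5 (★ `fourFrameTransferFactor_of
  depthOfRecord (fourFrameData _) (normPairs_iff_frames _)`), given a name in `Theorems/`; `fourFrameTransferFactorS_depthOfRecord (shift) : FourFrameTransferFactorS shift
  depthOfRecord` — the `hDΔ` input of ★ #11S at ANY schedule, in particular `fourFrameTransferFactorR_depthOfRecord : FourFrameTransferFactorR depthOfRecord` for the re-cut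
  socket that U2H ED. 5 ∕ the tier-0 row twins consume (`shift := shiftR`).  No new stub is created or implied (LEAD T18-09 (3): «no #5R ever» — these are helpers).

HONEST LABEL.  Count-neutral bookkeeping over ★ material; the verdict of record for (D-RAM) stays PRINT [LanglandsShelstad1989 Thm. p. 484 ∕ Rogawski1990 Prop. 4.9.1 (a)] ∕ XL;
`HC_CM` is proved only modulo the 7 printed citations (2 remaining: hLiu418 = `stmt-HodgeConjecture-24832`, h413 = `stmt-HodgeConjecture-24833`) until rung 0 closes.

## References
* [Rogawski1990] J. D. Rogawski, *Automorphic Representations of Unitary Groups in Three Variables*, Ann. of Math. Stud. 123 (1990), §4.3 (4.3.2) p. 43, §4.9 Prop. 4.9.1 p. 55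
  (the transfer factor near the identity; its κ-sign on the four classes).
* [LanglandsShelstad1987] R. P. Langlands, D. Shelstad, *On the definition of transfer factors*, Math. Ann. 278 (1987), §3 (Δ_I–Δ_IV).
-/

noncomputable section

namespace Summit.HodgeConjecture.HodgeConjecture.Cruxes.H413.F0P3cDyRamFourFrameTransferFactorShiftIndep

open MeasureTheory Measure NumberField IsDedekindDomain Topology Filter
open Literature.NumberTheory.Automorphic Literature.NumberTheory.Automorphic.UnitaryGroup Literature.NumberTheory.Automorphic.IntegralReduction
open Literature.NumberTheory.Automorphic.UnitaryLatticeTree Literature.NumberTheory.Automorphic.HermitianLattice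
open Literature.NumberTheory.Rogawski1990 Literature.NumberTheory.GaloisRepresentations
open Literature.NumberTheory.Automorphic.UnitaryThreeFourFrame
open scoped Matrix MatrixGroups Classical ValuativeRel WithZero
open Summit.HodgeConjecture.HodgeConjecture.Cruxes.H413.F0P3cDyRamFourFrameHSideDefs
open Summit.HodgeConjecture.HodgeConjecture.Cruxes.H413.F0P3cDyRamFourFrameHSideDefsR
open Summit.HodgeConjecture.HodgeConjecture.Cruxes.H413.F0P3cDyRamFourFrameLawDefsR (shiftT shiftR)

/-! ## §1  (R-16a): the parity datum is a dummy — schedule independence and the unconditional custody tie -/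

/-- **(R-16a) `FourFrameTransferFactorS s N₀ → FourFrameTransferFactorS s' N₀`**: the parity datum `B` of (D-CΔ)-S feeds no clause, so the Prop does not depend on the
schedule (`B ↦ B + s d t_E − s' d t_E`).  Proof: LH4-r01 (g0) BOX E §R, verbatim. [cite: Rogawski1990, §4.9 Prop. 4.9.1 p. 55] [cite: LanglandsShelstad1987, §3] -/
theorem fourFrameTransferFactorS_indep (s s' : ℕ → ℕ → ℤ) (N₀ : ℕ → ℕ) (h : FourFrameTransferFactorS s N₀) :
    FourFrameTransferFactorS s' N₀ := by
  intro L _ _ _ v w hw he h2 ϖ hϖ d tE hD μ hμu hμω _ _ _ _ _ _ _ _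
  obtain ⟨V, hV, hall⟩ := h L w hw he h2 ϖ hϖ d tE hD μ hμu hμω
  refine ⟨V, hV, fun γH hγ hreg hroot hnl => ?_⟩
  obtain ⟨f, hf, a, b, z, ha, hb, hz, hzpin, hra, hrb, ha1, hb1, n₁, n₂, n₃, hE, k, hk, Γ, hΓ, tb, htb, i, B, hB, hrest⟩ :=
    hall γH hγ hreg hroot hnl
  exact ⟨f, hf, a, b, z, ha, hb, hz, hzpin, hra, hrb, ha1, hb1, n₁, n₂, n₃, hE, k, hk, Γ, hΓ, tb, htb, i, B + s d tE - s' d tE,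
    by linarith, hrest⟩

/-- **`FourFrameTransferFactorS s N₀ ↔ FourFrameTransferFactorS s' N₀`** for any two schedules. [cite: Rogawski1990, §4.9 Prop. 4.9.1 p. 55] -/
theorem fourFrameTransferFactorS_iff (s s' : ℕ → ℕ → ℤ) (N₀ : ℕ → ℕ) : FourFrameTransferFactorS s N₀ ↔ FourFrameTransferFactorS s' N₀ :=
  ⟨fourFrameTransferFactorS_indep s s' N₀, fourFrameTransferFactorS_indep s' s N₀⟩

/-- **THE UNCONDITIONAL CUSTODY TIE (R-16a)**: the re-cut (D-CΔ)-R IS the (D-CΔ) of record, at every datum (★ T1 `fourFrameTransferFactorS_shiftT_iff` + §1).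
[cite: Rogawski1990, §4.9 Prop. 4.9.1 p. 55] [cite: LanglandsShelstad1987, §3] -/
theorem fourFrameTransferFactorR_iff_record (N₀ : ℕ → ℕ) : FourFrameTransferFactorR N₀ ↔ FourFrameTransferFactor N₀ :=
  ⟨fun h => (fourFrameTransferFactorS_shiftT_iff N₀).1 (fourFrameTransferFactorS_indep shiftR shiftT N₀ h),
   fun h => fourFrameTransferFactorS_indep shiftT shiftR N₀ ((fourFrameTransferFactorS_shiftT_iff N₀).2 h)⟩

/-! ## §2  The ★ value at the parameters of record, at every schedule -/

/-- **`FourFrameTransferFactor depthOfRecord`** (U2H stub #5's statement) — the ★ composition U2H ED. 4 writes: ★ p854932 `fourFrameTransferFactor_of` over ★ U1-3 `fourFrameData`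
and ★ U1-4 `normPairs_iff_frames`, given a name in `Theorems/`. [cite: Rogawski1990, §4.3 (4.3.2) p. 43; §4.9 Prop. 4.9.1 p. 55] [cite: LanglandsShelstad1987, §3] -/
theorem fourFrameTransferFactor_depthOfRecord : FourFrameTransferFactor depthOfRecord :=
  F0P3cDyRamTransferFactorTypeOne.fourFrameTransferFactor_of depthOfRecord (F0P3cDyRamFourFrameData.fourFrameData depthOfRecord)
    (F0P3cDyRamNormPairsIffFrames.normPairs_iff_frames depthOfRecord)

/-- **`FourFrameTransferFactorS shift depthOfRecord` AT EVERY SCHEDULE** — the `hDΔ` input of ★ #11S `anchorRows_of_fourFrameLawsS shift` at the parameters of record.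
[cite: Rogawski1990, §4.9 Prop. 4.9.1 p. 55] -/
theorem fourFrameTransferFactorS_depthOfRecord (shift : ℕ → ℕ → ℤ) : FourFrameTransferFactorS shift depthOfRecord :=
  fourFrameTransferFactorS_indep shiftT shift depthOfRecord ((fourFrameTransferFactorS_shiftT_iff depthOfRecord).2 fourFrameTransferFactor_depthOfRecord)

/-- **`FourFrameTransferFactorR depthOfRecord`** — (D-CΔ)-R at the parameters of record (the re-cut socket's `hDΔ`, `shift := shiftR`). [cite: Rogawski1990, §4.9 Prop. 4.9.1 p. 55] -/
theorem fourFrameTransferFactorR_depthOfRecord : FourFrameTransferFactorR depthOfRecord :=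
  fourFrameTransferFactorS_depthOfRecord shiftR

end Summit.HodgeConjecture.HodgeConjecture.Cruxes.H413.F0P3cDyRamFourFrameTransferFactorShiftIndep

end
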